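import Summits.QuantumFields.YangMills.Theorems.BalabanLadderNTReflectionCauchySchwarzPos
import Literature.MathematicalPhysics.QuantumFieldTheory.TomboulisYaffeTwistBound
import Literature.MathematicalPhysics.QuantumFieldTheory.WilsonEnergyConvexity
import Literature.MathematicalPhysics.QuantumFieldTheory.SpeciesTimeReflection
import HarnessLib

/-!
# Crux `NT` (stmt-QuantumFields-19353): the 't Hooft twist-flip witness and its RP floor

Support file (`--supports stmt-QuantumFields-19353`, ideator seat `ym-idea-8`, lens «dual», g14; tool T-g14-1 of the
census `Cruxes/NT/Lines/dual_subline_census.md` rev 3, sketched in `Cruxes/NT/Lines/dual_twist_witness_sketch.lean`).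
No summit and no crux is proved here; there are no definitions (the flip is written out, as in the tree's
`TomboulisYaffeTwistBound.lean`).

On the torus `(ℤ/Lℤ)^d` with Wilson measure `μ_β` (compact `G`, continuous matrix representation `ρ`) let
`W_{z,a}(U) = exp(β (S(U) − S_{z,(a,0)}(U)))` be the **twist flip**: the ratio of the Boltzmann weight with 't Hooft's
central twist `z` on the stack `{x_0 = a, x_ν = 0}` of `(0,ν)`-plaquettes (`stackInsertion z (0,ν) a 0`) to the untwisted
weight.  Two exact identities — `integral_twistFlip` : `∫ W_{z,a} dμ_β = Z_β(z)/Z_β(1) =: ϱ` (the tree's twisted partition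
function ratio) and `integral_twistFlip_negReflect_mul` : `∫ (W_{z,0}∘ϑ)·W_{z,0} dμ_β = 1` for the SITE reflection
`ϑ : t ↦ −t` (the reflected stack carries the opposite twist, `insertedWilsonAction_stack_negReflect`, and opposite twists
on adjacent stacks cancel by one coboundary move, `TomboulisYaffe.wilsonExpectation_twistObs_inv_mul_twistObs`;
Kanazawa's Lemmas 1–2) — turn the positive-half reflection Cauchy–Schwarz inequality of the crux folder
(`sq_cov_negReflect_le_odd_pos`, odd side `L = 2S+1`, `β ≥ 0`) into a FLOOR on the reflection-diagonal covariance of ANY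
bounded observable `F` of the closed non-negative half:

* `twistWitness_floor` : `(∫ F∘ϑ·W_z − ∫F·ϱ)² ≤ (∫ F∘ϑ·F − (∫F)²) · (1 − ϱ²)`.

The cross term is `ϱ` times the twisted expectation of `F∘ϑ` (`integral_mul_twistFlip`: the flip tilts `μ_β` to the
twisted measure), so the floor reads `Cov(F∘ϑ, F) ≥ ϱ²·(⟨F∘ϑ⟩_z − ⟨F⟩)²/(1 − ϱ²)`: an explicit one-sided lower bound for
reflection-diagonal plaquette covariances (`F` = a smeared plaquette density gives `Q2`-type quantities of
`LowerBounds`) from the RESPONSE of a local observable to a temporal-plane 't Hooft twist and the twist free energy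
`−log ϱ`.  The response does not depend on the height of the twisted stack (`integral_negSide_mul_twistFlip_succ`, the
tree's stack-moving substitution `TomboulisYaffe.integral_mul_exp_stack_succ`).  By-products: positive-half reflection
positivity on odd sides (`integral_negReflect_mul_self_nonneg`) and `twistedPartitionFunction_le_untwisted_odd`, extending
the tree's even-side `Z(z) ≤ Z(1)` (`twistedPartitionFunction_le_untwisted`) to odd sides `L = 2S+1 ≥ 3` (`β ≥ 0`).

Nearest in-tree art: `TomboulisYaffeTwistBound.lean` uses the same two identities (even sides, complex form) for the
Tomboulis–Yaffe CEILING on the Polyakov-loop correlator at separation `L/2` by `1 − ϱ`; here they give a FLOOR on an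
arbitrary positive-half covariance by the response.  Why only a TOOL for `NT` (census rev 3 §2d): the response dies once
the torus exceeds the confinement scale while `NT` quantifies over all `L` at fixed `β`; the floor is one-sided whereas
the spine's femto package needs floor and ceiling with a common rate; centre-free groups carry no twist.

Refs: 't Hooft, Nucl. Phys. B153 (1979) 141; Tomboulis–Yaffe, Comm. Math. Phys. 100 (1985) 313; Kanazawa
arXiv:0808.3442 §2 Lemmas 1–2; Osterwalder–Seiler 1978 §2.
-/

set_option autoImplicit false

noncomputable section

open MeasureTheory Finset
open Literature.MathematicalPhysics.QuantumFieldTheory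
open Literature.MathematicalPhysics.QuantumFieldTheory.WilsonRP
open Literature.MathematicalPhysics.QuantumFieldTheory.WilsonSiteRP
open Literature.MathematicalPhysics.QuantumFieldTheory.WilsonNegRP
open Literature.MathematicalPhysics.QuantumFieldTheory.FariaDaVeigaOCarroll2022

namespace Summit.QuantumFields.YangMills.Cruxes.NT.TwistWitness

variable {d L N : ℕ} [NeZero d] [NeZero L]
variable {G : Type*} [Group G] [TopologicalSpace G] [IsTopologicalGroup G] [CompactSpace G]
  [MeasurableSpace G] [BorelSpace G] (ρ : G →* Matrix (Fin N) (Fin N) ℂ) (β : ℝ) (z : G) (ν : Fin d)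
  (hν : (0 : Fin d) < ν)

/-! ## The twist flip `W_{z,a} = exp(β (S − S_{z,(a,0)}))`: elementary properties -/

omit [TopologicalSpace G] [IsTopologicalGroup G] [CompactSpace G] [MeasurableSpace G] [BorelSpace G] in
/-- `W_{z,a} · e^{-β S} = e^{-β S_{z,(a,0)}}`. [folklore] -/
theorem twistFlip_mul_exp (a : ZMod L) (U : GaugeConfig d L G) :
    Real.exp (β * (wilsonAction ρ U - insertedWilsonAction ρ (stackInsertion z ⟨(0, ν), hν⟩ a 0) U)) * Real.exp (-β * wilsonAction ρ U) =
      Real.exp (-(β * insertedWilsonAction ρ (stackInsertion z ⟨(0, ν), hν⟩ a 0) U)) := by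
  rw [← Real.exp_add]; congr 1; ring

omit [CompactSpace G] in
/-- `W_{z,a}` is measurable (continuous `ρ`). [folklore] -/
theorem measurable_twistFlip (hρ : Continuous ρ) (a : ZMod L) :
    Measurable fun U : GaugeConfig d L G => Real.exp (β * (wilsonAction ρ U - insertedWilsonAction ρ (stackInsertion z ⟨(0, ν), hν⟩ a 0) U)) :=
  Real.measurable_exp.comp (((WilsonRP.measurable_wilsonAction ρ hρ).sub
    (measurable_insertedWilsonAction ρ hρ _)).const_mul β)

omit [MeasurableSpace G] [BorelSpace G] in
/-- `W_{z,a}` is bounded (compact `G`). [folklore] -/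
theorem exists_abs_twistFlip_le (hρ : Continuous ρ) (a : ZMod L) :
    ∃ K : ℝ, ∀ U : GaugeConfig d L G, |Real.exp (β * (wilsonAction ρ U - insertedWilsonAction ρ (stackInsertion z ⟨(0, ν), hν⟩ a 0) U))| ≤ K := by
  obtain ⟨B, hB⟩ := exists_abs_wilsonAction_le (d := d) (L := L) ρ hρ
  refine ⟨Real.exp (|β| * (B + 2 * N * Fintype.card (Plaquette d L))), fun U => ?_⟩
  rw [Real.abs_exp]
  refine Real.exp_le_exp.2 ((le_abs_self _).trans ?_)
  rw [abs_mul]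
  exact mul_le_mul_of_nonneg_left ((abs_sub _ _).trans (add_le_add (hB U)
    (abs_insertedWilsonAction_le ρ hρ (stackInsertion z ⟨(0, ν), hν⟩ a 0) U))) (abs_nonneg _)

/-! ## Identity 1: `∫ W_{z,a} dμ_β = Z(z)/Z(1)`; the flip tilts `μ_β` to the twisted measure -/

/-- **`⟨W_{z,a}⟩_β = Z_β(z; a)/Z_β(1)`**: the Wilson expectation of the twist flip is the ratio of 't Hooft's twisted
partition function (stack at height `a`; for `a = 0` this is `twistedPartitionFunction ρ β L z (0,ν)` by `rfl`, and for
central `z` every height gives the same number, `twistedPartitionFunctionAt_eq`) to the untwisted one.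
(`TomboulisYaffe.wilsonExpectation_twistObs` is the complex form.) [cite: Kanazawa2008, §2 eq. (8)] -/
theorem integral_twistFlip (hρ : Continuous ρ) (a : ZMod L) :
    ∫ U : GaugeConfig d L G, Real.exp (β * (wilsonAction ρ U - insertedWilsonAction ρ (stackInsertion z ⟨(0, ν), hν⟩ a 0) U)) ∂(wilsonMeasure ρ β) =
      twistedPartitionFunctionAt ρ β L z ⟨(0, ν), hν⟩ a 0 / twistedPartitionFunction ρ β L 1 ⟨(0, ν), hν⟩ := by
  have h := wilsonExpectation_eq_integral_div ρ hρ β fun U : GaugeConfig d L G => Real.exp (β * (wilsonAction ρ U - insertedWilsonAction ρ (stackInsertion z ⟨(0, ν), hν⟩ a 0) U))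
  unfold wilsonExpectation at h
  rw [h, twistedPartitionFunction_one ρ hρ β, partitionFunction_toReal_eq_integral ρ hρ β]
  congr 1
  simp_rw [twistFlip_mul_exp]
  rfl

/-- **The flip tilts the measure to the twisted one**: `∫ X·W_{z,a} dμ_β = (∫ X e^{-β S_{z,(a,0)}} dHaar)/(∫ e^{-β S} dHaar)`,
i.e. `ϱ·⟨X⟩_z` with `⟨·⟩_z` the twisted expectation: the cross term of the floor below is `ϱ` times the twisted expectation
of `F∘ϑ` (its RESPONSE to the twist, after subtracting `ϱ⟨F⟩`). [cite: TomboulisYaffe1985, §II eq. (2.8)] -/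
theorem integral_mul_twistFlip (hρ : Continuous ρ) (a : ZMod L) (X : GaugeConfig d L G → ℝ) :
    ∫ U : GaugeConfig d L G, X U * Real.exp (β * (wilsonAction ρ U - insertedWilsonAction ρ (stackInsertion z ⟨(0, ν), hν⟩ a 0) U)) ∂(wilsonMeasure ρ β) =
      (∫ U : GaugeConfig d L G, X U * Real.exp (-(β * insertedWilsonAction ρ (stackInsertion z ⟨(0, ν), hν⟩ a 0) U))
          ∂(Measure.pi fun _ : Edge d L => haarProbability G)) /
        ∫ U : GaugeConfig d L G, Real.exp (-β * wilsonAction ρ U) ∂(Measure.pi fun _ : Edge d L => haarProbability G) := by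
  have h := wilsonExpectation_eq_integral_div ρ hρ β fun U : GaugeConfig d L G => X U * Real.exp (β * (wilsonAction ρ U - insertedWilsonAction ρ (stackInsertion z ⟨(0, ν), hν⟩ a 0) U))
  unfold wilsonExpectation at h
  rw [h]
  congr 1
  refine integral_congr_ae (ae_of_all _ fun U => ?_)
  simp only [mul_assoc, twistFlip_mul_exp]

/-! ## Identity 2: `∫ (W_{z,0}∘ϑ) · W_{z,0} dμ_β = 1` -/

omit [MeasurableSpace G] [BorelSpace G] in
/-- **Reflection reverses the twist**: `W_{z,a}(ϑU) = exp(β (S(U) − S_{z⁻¹,(−(a+1),0)}(U)))` with the `z⁻¹`-twist on the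
reflected stack (the tree's `insertedWilsonAction_stack_negReflect` and `wilsonAction_negReflect_eq`;
`TomboulisYaffe.twistObs_negReflect` is the even-side instance). [cite: Kanazawa2008, §2 Lemma 2 eq. (15)] -/
theorem twistFlip_negReflect (hρ : Continuous ρ) (hz : z ∈ Subgroup.center G) (a : ZMod L) (U : GaugeConfig d L G) :
    Real.exp (β * (wilsonAction ρ U.negReflect - insertedWilsonAction ρ (stackInsertion z ⟨(0, ν), hν⟩ a 0) U.negReflect)) =
      Real.exp (β * (wilsonAction ρ U - insertedWilsonAction ρ (stackInsertion z⁻¹ ⟨(0, ν), hν⟩ (-(a + 1)) 0) U)) := by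
  rw [insertedWilsonAction_stack_negReflect ρ hρ hz ν hν a 0 U, wilsonAction_negReflect_eq ρ hρ U]

/-- **`∫ (W_{z,0}∘ϑ)·W_{z,0} dμ_β = 1`** (central `z`, side `L ≥ 2`): the reflected flip carries the opposite twist on the
adjacent stack `{x_0 = −1}` (`twistFlip_negReflect`), and opposite twists on adjacent stacks cancel by one central
coboundary move (the tree's `TomboulisYaffe.wilsonExpectation_twistObs_inv_mul_twistObs`, real form).
[cite: Kanazawa2008, §2 Lemma 1 eq. (11) and Lemma 2 eq. (15)] -/
theorem integral_twistFlip_negReflect_mul (hL : 1 < L) (hρ : Continuous ρ) (hz : z ∈ Subgroup.center G) :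
    ∫ U : GaugeConfig d L G, Real.exp (β * (wilsonAction ρ U.negReflect - insertedWilsonAction ρ (stackInsertion z ⟨(0, ν), hν⟩ 0 0) U.negReflect)) *
        Real.exp (β * (wilsonAction ρ U - insertedWilsonAction ρ (stackInsertion z ⟨(0, ν), hν⟩ 0 0) U)) ∂(wilsonMeasure ρ β) = 1 := by
  haveI : Fact (1 < L) := ⟨hL⟩
  have h := TomboulisYaffe.wilsonExpectation_twistObs_inv_mul_twistObs ρ hρ β hz ⟨(0, ν), hν⟩ (-1 : ZMod L) 0
  simp only [neg_add_cancel] at h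
  unfold wilsonExpectation at h
  simp_rw [← Complex.ofReal_mul] at h
  rw [integral_complex_ofReal] at h
  simp_rw [twistFlip_negReflect ρ β z ν hν hρ hz, zero_add]
  exact_mod_cast h

/-! ## The flip lives on the closed non-negative half -/

omit [TopologicalSpace G] [IsTopologicalGroup G] [CompactSpace G] [MeasurableSpace G] [BorelSpace G] in
/-- `S − S_{z,(0,0)}` only involves the stack plaquettes, whose links sit at times `0` and `1`: the twist flip `W_{z,0}` is
an observable of the closed non-negative half `{e | both endpoints at times ≤ S}` of the torus of side `2S+1`, `S ≥ 1`.
[folklore] -/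
theorem dependsOn_twistFlip {S : ℕ} (hL : L = 2 * S + 1) (hS : 1 ≤ S) :
    DependsOn (fun U : GaugeConfig d L G => Real.exp (β * (wilsonAction ρ U - insertedWilsonAction ρ (stackInsertion z ⟨(0, ν), hν⟩ 0 0) U)))
      {e : Edge d L | (e.1 0).val ≤ S ∧ ((e.1.shift e.2) 0).val ≤ S} := by
  haveI : Fact (1 < L) := ⟨by omega⟩
  intro U V hUV
  have hUV' : ∀ e : Edge d L, (e.1 0).val ≤ S → ((e.1.shift e.2) 0).val ≤ S → U e = V e :=
    fun e h1 h2 => hUV e ⟨h1, h2⟩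
  have key : wilsonAction ρ U - insertedWilsonAction ρ (stackInsertion z ⟨(0, ν), hν⟩ 0 0) U =
      wilsonAction ρ V - insertedWilsonAction ρ (stackInsertion z ⟨(0, ν), hν⟩ 0 0) V := by
    unfold wilsonAction insertedWilsonAction
    rw [← Finset.sum_sub_distrib, ← Finset.sum_sub_distrib]
    refine Finset.sum_congr rfl fun p _ => ?_
    unfold stackInsertion
    by_cases hp : p.2 = ⟨(0, ν), hν⟩ ∧ p.1 (0 : Fin d) = 0 ∧ p.1 ν = 0
    · obtain ⟨x, q⟩ := p
      obtain ⟨hq, hx0, hxν⟩ := hp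
      dsimp only at hq hx0 hxν
      subst hq
      simp only [and_self, ↓reduceIte, hx0, hxν]
      have hν' : (0 : Fin d) ≠ ν := hν.ne
      have v0 : (x 0).val ≤ S := by rw [hx0, ZMod.val_zero]; exact Nat.zero_le _
      have v1 : ((x.shift 0) 0).val ≤ S := by rw [shift_apply_self, hx0, zero_add, ZMod.val_one]; exact hS
      have vν : ((x.shift ν) 0).val ≤ S := by rw [shift_apply_of_ne _ hν', hx0, ZMod.val_zero]; exact Nat.zero_le _
      have v0ν : (((x.shift 0).shift ν) 0).val ≤ S := by rw [shift_apply_of_ne _ hν']; exact v1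
      have vν0 : (((x.shift ν).shift 0) 0).val ≤ S := by
        rw [shift_apply_self, shift_apply_of_ne _ hν', hx0, zero_add, ZMod.val_one]; exact hS
      have e1 : U (x, 0) = V (x, 0) := hUV' (x, 0) v0 v1
      have e2 : U (x.shift 0, ν) = V (x.shift 0, ν) := hUV' (x.shift 0, ν) v1 v0ν
      have e3 : U (x.shift ν, 0) = V (x.shift ν, 0) := hUV' (x.shift ν, 0) vν vν0
      have e4 : U (x, ν) = V (x, ν) := hUV' (x, ν) v0 vν
      simp only [plaquetteHolonomy, e1, e2, e3, e4]
    · have hp' : ¬ (p.2 = ⟨(0, ν), hν⟩ ∧ p.1 (⟨(0, ν), hν⟩ : {p : Fin d × Fin d // p.1 < p.2}).1.1 = 0 ∧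
          p.1 (⟨(0, ν), hν⟩ : {p : Fin d × Fin d // p.1 < p.2}).1.2 = 0) := hp
      simp only [hp', ↓reduceIte, one_mul, sub_self]
  show Real.exp _ = Real.exp _
  rw [key]

/-! ## Moving the stack: the response does not depend on the position of the twist -/

/-- **Moving the twisted stack by one unit does not change `∫ X·W` for observables blind to the moved links**: if `X` is
invariant under left multiplication by the central cochain `c = z⁻¹` on the `ν`-links `{y_0 = a+1, y_ν = 0}` (in particular
if `X` does not depend on those links), then `∫ X·W_{z,a} dμ_β = ∫ X·W_{z,a+1} dμ_β` (the tree's stack-moving substitution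
`TomboulisYaffe.integral_mul_exp_stack_succ`, real form). [cite: TomboulisYaffe1985, App. I §C] -/
theorem integral_mul_twistFlip_succ (hρ : Continuous ρ) (hz : z ∈ Subgroup.center G) (a : ZMod L)
    (X : GaugeConfig d L G → ℝ)
    (hX : ∀ U : GaugeConfig d L G,
      X ((fun e : Edge d L => if e.2 = ν ∧ e.1 0 = a + 1 ∧ e.1 ν = 0 then z⁻¹ else 1) * U) = X U) :
    ∫ U : GaugeConfig d L G, X U * Real.exp (β * (wilsonAction ρ U - insertedWilsonAction ρ (stackInsertion z ⟨(0, ν), hν⟩ a 0) U)) ∂(wilsonMeasure ρ β) =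
      ∫ U : GaugeConfig d L G, X U * Real.exp (β * (wilsonAction ρ U - insertedWilsonAction ρ (stackInsertion z ⟨(0, ν), hν⟩ (a + 1) 0) U)) ∂(wilsonMeasure ρ β) := by
  rw [integral_mul_twistFlip ρ β z ν hν hρ a, integral_mul_twistFlip ρ β z ν hν hρ (a + 1)]
  congr 1
  -- the complex-valued tree identity, specialised to the real observable `X`
  have key := TomboulisYaffe.integral_mul_exp_stack_succ ρ β hz ⟨(0, ν), hν⟩ a 0 (fun U => (X U : ℂ))
  have hc : (fun e : Edge d L => if e.2 = (⟨(0, ν), hν⟩ : {p : Fin d × Fin d // p.1 < p.2}).1.2 ∧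
      e.1 (⟨(0, ν), hν⟩ : {p : Fin d × Fin d // p.1 < p.2}).1.1 = a + 1 ∧
      e.1 (⟨(0, ν), hν⟩ : {p : Fin d × Fin d // p.1 < p.2}).1.2 = 0 then z⁻¹ else (1 : G)) =
      fun e : Edge d L => if e.2 = ν ∧ e.1 0 = a + 1 ∧ e.1 ν = 0 then z⁻¹ else 1 := rfl
  simp only [hc, hX] at key
  simp_rw [← Complex.ofReal_mul] at key
  rw [integral_complex_ofReal, integral_complex_ofReal] at key
  exact_mod_cast key

omit [NeZero L] [TopologicalSpace G] [IsTopologicalGroup G] [CompactSpace G] [MeasurableSpace G] [BorelSpace G] in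
/-- An observable of a set of links avoiding the moved `ν`-links `{y_0 = a+1, y_ν = 0}` is blind to the stack move.
[folklore] -/
theorem apply_cochain_mul_eq_of_dependsOn (a : ZMod L) {X : GaugeConfig d L G → ℝ} {E : Set (Edge d L)}
    (hXdep : DependsOn X E) (hE : ∀ e ∈ E, ¬ (e.2 = ν ∧ e.1 0 = a + 1 ∧ e.1 ν = 0)) (U : GaugeConfig d L G) :
    X ((fun e : Edge d L => if e.2 = ν ∧ e.1 0 = a + 1 ∧ e.1 ν = 0 then z⁻¹ else 1) * U) = X U :=
  hXdep fun e he => by simp only [Pi.mul_apply, if_neg (hE e he), one_mul]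

/-- **Position independence of the response for observables of the negative blocks**: if `X` depends only on the links
of `negSideEdges S ∪ sliceZeroEdges` (times `≥ S+1` and the spatial slice `t = 0`; e.g. `X = F∘ϑ` for `F` on the closed
non-negative half, `Reflection.dependsOn_negReflect_of_posHalf`), then `∫ X·W_{z,a} dμ_β = ∫ X·W_{z,a+1} dμ_β` whenever
the moved links sit at a time `a + 1` with `1 ≤ (a+1).val ≤ S`: every stack height `0 … S` gives the same response.
[cite: TomboulisYaffe1985, App. I §C] -/
theorem integral_negSide_mul_twistFlip_succ {S : ℕ} (hρ : Continuous ρ) (hz : z ∈ Subgroup.center G) (a : ZMod L)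
    (ha1 : 1 ≤ (a + 1).val) (haS : (a + 1).val ≤ S) {X : GaugeConfig d L G → ℝ}
    (hXdep : DependsOn X ((negSideEdges S ∪ sliceZeroEdges : Finset (Edge d L)) : Set (Edge d L))) :
    ∫ U : GaugeConfig d L G, X U * Real.exp (β * (wilsonAction ρ U - insertedWilsonAction ρ (stackInsertion z ⟨(0, ν), hν⟩ a 0) U)) ∂(wilsonMeasure ρ β) =
      ∫ U : GaugeConfig d L G, X U * Real.exp (β * (wilsonAction ρ U - insertedWilsonAction ρ (stackInsertion z ⟨(0, ν), hν⟩ (a + 1) 0) U)) ∂(wilsonMeasure ρ β) := by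
  refine integral_mul_twistFlip_succ ρ β z ν hν hρ hz a X fun U =>
    apply_cochain_mul_eq_of_dependsOn z ν a hXdep (fun e he hmove => ?_) U
  obtain ⟨-, he0, -⟩ := hmove
  have he' := mem_coe.1 he
  simp only [mem_union, negSideEdges, sliceZeroEdges, mem_filter, mem_univ, true_and] at he'
  rw [he0] at he'
  omega

/-! ## Reflection positivity on the closed non-negative half (odd side) and `Z(z) ≤ Z(1)` for odd sides -/

/-- **Reflection positivity, positive-half form, odd side**: `0 ≤ ∫ F∘ϑ·F dμ_β` for a bounded measurable real
observable `F` of the closed non-negative half of the torus of side `2S+1` (`S ≥ 1`, `β ≥ 0`).  Transport of the crux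
folder's `integral_mul_timeReflect_nonneg_odd` along `ϑ` (`dependsOn_negReflect_of_posHalf`) and the translation
`t ↦ t − S` (`negReflect_torusConfigShift`), exactly as in `sq_cov_negReflect_le_odd(_pos)`.
[cite: OsterwalderSeiler1978, §2] -/
theorem integral_negReflect_mul_self_nonneg {S : ℕ} (hL : L = 2 * S + 1) (hS : 1 ≤ S) (hρ : Continuous ρ)
    (hβ : 0 ≤ β) {F : GaugeConfig d L G → ℝ} (hFm : Measurable F) (hFb : ∃ K : ℝ, ∀ U, |F U| ≤ K)
    (hFdep : DependsOn F {e : Edge d L | (e.1 0).val ≤ S ∧ ((e.1.shift e.2) 0).val ≤ S}) :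
    0 ≤ ∫ U : GaugeConfig d L G, F U.negReflect * F U ∂(wilsonMeasure ρ β) := by
  have hodd : Odd L := ⟨S, hL⟩
  have hL3 : 3 ≤ L := by omega
  have hϑm : Measurable (GaugeConfig.negReflect : GaugeConfig d L G → GaugeConfig d L G) := measurable_negReflect
  have hAdep := Reflection.dependsOn_negReflect_of_posHalf hL hS hFdep
  have h1 : ∫ U : GaugeConfig d L G, F U.negReflect * F U ∂(wilsonMeasure ρ β) =
      ∫ U : GaugeConfig d L G, F U.negReflect * F U.negReflect.negReflect ∂(wilsonMeasure ρ β) := by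
    simp only [negReflect_negReflect_config]
  -- translate by `τ : t ↦ t − S`, which conjugates `ϑ` to the link reflection `Θ`
  set τ := torusConfigShift (G := G) (shiftVec (d := d) (L := L) S) with hτ
  have hτm : Measurable τ := (torusConfigShift (G := G) (shiftVec (d := d) (L := L) S)).measurable
  have hshift : ∀ Φ : GaugeConfig d L G → ℝ,
      ∫ U, Φ U ∂(wilsonMeasure ρ β) = ∫ U, Φ (τ U) ∂(wilsonMeasure ρ β) := by
    intro Φ
    have h := wilsonExpectation_comp_torusConfigShift ρ β (shiftVec (d := d) (L := L) S) Φ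
    unfold wilsonExpectation at h
    exact h.symm
  rw [h1, hshift (fun U => F U.negReflect * F U.negReflect.negReflect)]
  simp only [hτ, negReflect_torusConfigShift hL]
  have key := Reflection.integral_mul_timeReflect_nonneg_odd ρ hodd hL3 hρ hβ
    (F := fun U => F (torusConfigShift (G := G) (shiftVec (d := d) (L := L) S) U).negReflect)
    ((hFm.comp hϑm).comp hτm) (hFb.imp fun K hK U => hK _)
    (Reflection.dependsOn_comp_shift_of_negSide hL hS hAdep)
  simpa only [negReflect_torusConfigShift hL] using key

/-- **`Z_β(z) ≤ Z_β(1)` on tori of ODD side** `L = 2S+1 ≥ 3` (`β ≥ 0`, central `z`, plane `(0,ν)`): the twist-flip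
witness has `∫ (W − ϱ)∘ϑ·(W − ϱ) dμ_β = 1 − ϱ² ≥ 0`.  The tree's `twistedPartitionFunction_le_untwisted` is the even-side
statement (all real `β`); the odd side uses the odd-torus reflection positivity of the crux folder.
[cite: Kanazawa2008, §2 Lemma 2 eq. (17)] -/
theorem twistedPartitionFunction_le_untwisted_odd {S : ℕ} (hL : L = 2 * S + 1) (hS : 1 ≤ S) (hρ : Continuous ρ)
    (hβ : 0 ≤ β) (hz : z ∈ Subgroup.center G) :
    twistedPartitionFunction ρ β L z ⟨(0, ν), hν⟩ ≤ twistedPartitionFunction ρ β L 1 ⟨(0, ν), hν⟩ := by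
  haveI := isProbabilityMeasure_wilsonMeasure (d := d) (L := L) ρ hρ β
  set W : GaugeConfig d L G → ℝ := fun U => Real.exp (β * (wilsonAction ρ U - insertedWilsonAction ρ (stackInsertion z ⟨(0, ν), hν⟩ 0 0) U)) with hW
  set ϱ : ℝ := ∫ U : GaugeConfig d L G, W U ∂(wilsonMeasure ρ β) with hϱ
  have hWm : Measurable W := measurable_twistFlip (L := L) ρ β z ν hν hρ 0
  obtain ⟨K, hK⟩ := exists_abs_twistFlip_le (L := L) ρ β z ν hν hρ 0
  -- reflection positivity for the centred flip, an observable of the non-negative half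
  have hpos := integral_negReflect_mul_self_nonneg ρ β hL hS hρ hβ (F := fun U => W U - ϱ)
    (hWm.sub measurable_const) ⟨K + |ϱ|, fun U => (abs_sub _ _).trans (add_le_add (hK U) le_rfl)⟩
    (fun U V hUV => by simp only [hW, dependsOn_twistFlip ρ β z ν hν hL hS hUV])
  -- expand: `∫ (W∘ϑ − ϱ)(W − ϱ) = ∫ W∘ϑ·W − ϱ² = 1 − ϱ²`
  have hWi : Integrable W (wilsonMeasure (d := d) (L := L) ρ β) := Reflection.integrable_wilson_of_bdd ρ hρ β hWm ⟨K, hK⟩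
  have hWϑi : Integrable (fun U : GaugeConfig d L G => W U.negReflect) (wilsonMeasure ρ β) :=
    Reflection.integrable_wilson_of_bdd ρ hρ β (hWm.comp measurable_negReflect) ⟨K, fun U => hK _⟩
  have hWWi : Integrable (fun U : GaugeConfig d L G => W U.negReflect * W U) (wilsonMeasure ρ β) :=
    Reflection.integrable_wilson_of_bdd ρ hρ β ((hWm.comp measurable_negReflect).mul hWm)
      ⟨K * K, fun U => by rw [abs_mul]; exact mul_le_mul (hK _) (hK U) (abs_nonneg _) ((abs_nonneg _).trans (hK U))⟩
  have hexp : ∫ U : GaugeConfig d L G, (W U.negReflect - ϱ) * (W U - ϱ) ∂(wilsonMeasure ρ β) = 1 - ϱ ^ 2 := by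
    have hpt : ∀ U : GaugeConfig d L G, (W U.negReflect - ϱ) * (W U - ϱ) =
        W U.negReflect * W U - ϱ * W U - ϱ * W U.negReflect + ϱ * ϱ := fun U => by ring
    simp_rw [hpt]
    have iB : Integrable (fun U : GaugeConfig d L G => ϱ * W U) (wilsonMeasure ρ β) := hWi.const_mul ϱ
    have iC : Integrable (fun U : GaugeConfig d L G => ϱ * W U.negReflect) (wilsonMeasure ρ β) := hWϑi.const_mul ϱ
    have iAB : Integrable (fun U : GaugeConfig d L G => W U.negReflect * W U - ϱ * W U) (wilsonMeasure ρ β) :=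
      hWWi.sub iB
    have iABC : Integrable (fun U : GaugeConfig d L G => W U.negReflect * W U - ϱ * W U - ϱ * W U.negReflect)
        (wilsonMeasure ρ β) := iAB.sub iC
    rw [integral_add iABC (integrable_const _), integral_sub iAB iC, integral_sub hWWi iB, integral_const_mul,
      integral_const_mul, integral_const, probReal_univ, one_smul, hW,
      integral_twistFlip_negReflect_mul ρ β z ν hν (by omega) hρ hz,
      Reflection.integral_comp_negReflect_odd ρ hL hρ β W, ← hϱ]
    ring
  rw [hexp] at hpos
  -- `ϱ = Z(z)/Z(1) > 0`, so `ϱ² ≤ 1` gives `ϱ ≤ 1`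
  have hZ1 : 0 < twistedPartitionFunction ρ β L 1 ⟨(0, ν), hν⟩ := twistedPartitionFunction_pos ρ hρ β 1 _
  have hϱeq : ϱ = twistedPartitionFunction ρ β L z ⟨(0, ν), hν⟩ / twistedPartitionFunction ρ β L 1 ⟨(0, ν), hν⟩ :=
    integral_twistFlip ρ β z ν hν hρ 0
  have hϱpos : 0 < ϱ := by rw [hϱeq]; exact div_pos (twistedPartitionFunction_pos ρ hρ β z _) hZ1
  have hϱle : ϱ ≤ 1 := by nlinarith
  rw [hϱeq, div_le_one hZ1] at hϱle
  exact hϱle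

/-! ## The floor -/

/-- **The twist-witness floor (RP form).**  On the torus of odd side `L = 2S+1` (`S ≥ 1`), for `β ≥ 0`, a central twist
`z` and every bounded measurable real observable `F` of the closed non-negative half:
`(∫ F∘ϑ·W_z − ∫F·∫W_z)² ≤ (∫ F∘ϑ·F − (∫F)²) · (1 − (∫W_z)²)`, `W_z = W_{z,0}`.
Reflection Cauchy–Schwarz (`sq_cov_negReflect_le_odd_pos`) with the spectator `W_z`, whose reflection-diagonal second
moment is exactly `1` (`integral_twistFlip_negReflect_mul`). [cite: Kanazawa2008, §2 Lemma 2] -/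
theorem twistWitness_floor {S : ℕ} (hL : L = 2 * S + 1) (hS : 1 ≤ S) (hρ : Continuous ρ) (hβ : 0 ≤ β)
    (hz : z ∈ Subgroup.center G) {F : GaugeConfig d L G → ℝ} (hFm : Measurable F) (hFb : ∃ K : ℝ, ∀ U, |F U| ≤ K)
    (hFdep : DependsOn F {e : Edge d L | (e.1 0).val ≤ S ∧ ((e.1.shift e.2) 0).val ≤ S}) :
    (∫ U : GaugeConfig d L G, F U.negReflect * Real.exp (β * (wilsonAction ρ U - insertedWilsonAction ρ (stackInsertion z ⟨(0, ν), hν⟩ 0 0) U)) ∂(wilsonMeasure ρ β) -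
        (∫ U, F U ∂(wilsonMeasure ρ β)) *
          ∫ U : GaugeConfig d L G, Real.exp (β * (wilsonAction ρ U - insertedWilsonAction ρ (stackInsertion z ⟨(0, ν), hν⟩ 0 0) U)) ∂(wilsonMeasure ρ β)) ^ 2 ≤
      (∫ U, F U.negReflect * F U ∂(wilsonMeasure ρ β) - (∫ U, F U ∂(wilsonMeasure ρ β)) ^ 2) *
        (1 - (∫ U : GaugeConfig d L G, Real.exp (β * (wilsonAction ρ U - insertedWilsonAction ρ (stackInsertion z ⟨(0, ν), hν⟩ 0 0) U)) ∂(wilsonMeasure ρ β)) ^ 2) := by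
  have key := Reflection.sq_cov_negReflect_le_odd_pos ρ hL hS hρ hβ hFm (measurable_twistFlip ρ β z ν hν hρ 0) hFb
    (exists_abs_twistFlip_le ρ β z ν hν hρ 0) hFdep (dependsOn_twistFlip ρ β z ν hν hL hS)
  rwa [integral_twistFlip_negReflect_mul ρ β z ν hν (by omega) hρ hz] at key

/-- **The twist-witness floor, partition-function form.**  Same, with `∫ W_z dμ_β` replaced by the ratio
`ϱ = Z_β(z)/Z_β(1)` of 't Hooft's twisted to the untwisted partition function:
`(∫ F∘ϑ·W_z − ϱ·∫F)² ≤ (∫ F∘ϑ·F − (∫F)²) · (1 − ϱ²)`, i.e. for `ϱ < 1`,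
`Cov_ϑ(F, F) ≥ ϱ² (⟨F∘ϑ⟩_z − ⟨F⟩)² / (1 − ϱ²)` with `⟨·⟩_z` the twisted expectation (`integral_mul_twistFlip`).
[cite: Kanazawa2008, §2 Lemma 2] -/
theorem twistWitness_floor_ratio {S : ℕ} (hL : L = 2 * S + 1) (hS : 1 ≤ S) (hρ : Continuous ρ) (hβ : 0 ≤ β)
    (hz : z ∈ Subgroup.center G) {F : GaugeConfig d L G → ℝ} (hFm : Measurable F) (hFb : ∃ K : ℝ, ∀ U, |F U| ≤ K)
    (hFdep : DependsOn F {e : Edge d L | (e.1 0).val ≤ S ∧ ((e.1.shift e.2) 0).val ≤ S}) :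
    (∫ U : GaugeConfig d L G, F U.negReflect * Real.exp (β * (wilsonAction ρ U - insertedWilsonAction ρ (stackInsertion z ⟨(0, ν), hν⟩ 0 0) U)) ∂(wilsonMeasure ρ β) -
        (twistedPartitionFunction ρ β L z ⟨(0, ν), hν⟩ / twistedPartitionFunction ρ β L 1 ⟨(0, ν), hν⟩) *
          ∫ U, F U ∂(wilsonMeasure ρ β)) ^ 2 ≤
      (∫ U, F U.negReflect * F U ∂(wilsonMeasure ρ β) - (∫ U, F U ∂(wilsonMeasure ρ β)) ^ 2) *
        (1 - (twistedPartitionFunction ρ β L z ⟨(0, ν), hν⟩ / twistedPartitionFunction ρ β L 1 ⟨(0, ν), hν⟩) ^ 2) := by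
  have key := twistWitness_floor ρ β z ν hν hL hS hρ hβ hz hFm hFb hFdep
  rw [integral_twistFlip ρ β z ν hν hρ 0] at key
  rwa [mul_comm (∫ U, F U ∂(wilsonMeasure ρ β))] at key

end Summit.QuantumFields.YangMills.Cruxes.NT.TwistWitness

end
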